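import Mathlib.RingTheory.DedekindDomain.FiniteAdeleRing
import Mathlib.RingTheory.ClassGroup.Basic
import HarnessLib

/-!
# Finite ideles and ideal classes: reduction of a finite idele to a unit idele

Trunk `AutomorphicAxiomatic` (G19), topic `NumberTheory/Automorphic`; namespace `Literature.Automorphic`.

Let `R` be a Dedekind domain with fraction field `K`, `𝔸_K^∞ = Πʳ_v K_v` its finite adele ring
(Mathlib `IsDedekindDomain.FiniteAdeleRing R K`) and `(𝔸_K^∞)ˣ` the finite ideles.  Following
Cassels–Fröhlich, Ch. II §17 ("Ideals and divisors"), a finite idele `x = (x_v)_v` has an order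
`ord_v x ∈ ℤ` at every `v` (`|x_v|_v = q_v ^ (-ord_v x)`), zero for almost all `v`, and hence an
associated fractional ideal `∏_v v ^ (ord_v x)`; the idele `(k)_v` of `k ∈ Kˣ` is sent to the
principal fractional ideal `(k)` ("The image of `kˣ ⊂ J_k` is the group of principal ideals").

The main result of this file, `FiniteAdeleRing.exists_finset_forall_exists_unitOrd_eq_zero`, is the
idelic form of the **finiteness of the ideal class group**: if `ClassGroup R` is finite (Mathlib:
`NumberField.RingOfIntegers.instFintypeClassGroup` for rings of integers of number fields), there is
a finite set `T` of finite ideles such that every finite idele `x` can be written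
`x = k · t · u` with `k ∈ Kˣ` principal, `t ∈ T`, and `u` a unit idele (`ord_v u = 0`, i.e.
`u_v ∈ 𝒪_vˣ`, for all `v`).  This is the reduction step by which the compactness of the norm-one
idele class group `J_k^1 / kˣ` is "more usual[ly]" deduced from the finiteness of the class number
and Dirichlet's unit theorem (Cassels–Fröhlich, Ch. II §18, closing remark; PDF p. 123 of the held
copy, §16 Theorem being on PDF p. 121).

## Main definitions and results

* `FiniteAdeleRing.unitOrd R K x v : ℤ` — the order `ord_v x` of the finite idele `x` at `v`.
* `FiniteAdeleRing.toFractionalIdeal R K x` — the fractional ideal `∏_v v ^ (ord_v x)` of `x`;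
  `count_toFractionalIdeal : count K v (toFractionalIdeal x) = ord_v x`.
* `FractionalIdeal.count_spanSingleton_eq_neg_log_valuation` — for `k ∈ Kˣ`,
  `val_v((k)) = ord_v k` (link between Mathlib's `FractionalIdeal.count` and
  `HeightOneSpectrum.valuation`).
* `FiniteAdeleRing.exists_finset_forall_exists_unitOrd_eq_zero` — the reduction theorem above.

## References

* J. W. S. Cassels, A. Fröhlich (eds.), *Algebraic Number Theory* (1967), Ch. II (Cassels,
  *Global fields*) §17 (the map `J_k → I_k`, `α ↦ ∑ (ord_v α) · v`; Theorem: finiteness of the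
  class group) and §18 (closing remark). [CasselsFrohlichANT1967]
-/

noncomputable section

open IsDedekindDomain IsDedekindDomain.HeightOneSpectrum WithZero
open scoped nonZeroDivisors

namespace Literature.NumberTheory.Automorphic

variable (R : Type*) [CommRing R] [IsDedekindDomain R] (K : Type*) [Field K] [Algebra R K]
  [IsFractionRing R K]

/-! ### Components of finite ideles -/

namespace FiniteAdeleRing

variable {R K}

/-- Components of the finite adele `1` are `1` (definitional). [folklore] -/
theorem coe_one_apply (v : HeightOneSpectrum R) : (1 : FiniteAdeleRing R K) v = 1 := rfl

/-- The `v`-component of a finite idele times that of its inverse is `1`. [folklore] -/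
theorem val_apply_mul_inv_apply (x : (FiniteAdeleRing R K)ˣ) (v : HeightOneSpectrum R) :
    (x : FiniteAdeleRing R K) v * ((x⁻¹ : (FiniteAdeleRing R K)ˣ) : FiniteAdeleRing R K) v = 1 := by
  change ((x : FiniteAdeleRing R K) * ((x⁻¹ : (FiniteAdeleRing R K)ˣ) : FiniteAdeleRing R K)) v = 1
  rw [← Units.val_mul, mul_inv_cancel, Units.val_one, coe_one_apply]

/-- The components of a finite idele have non-zero valuation. [folklore] -/
theorem valued_apply_ne_zero (x : (FiniteAdeleRing R K)ˣ) (v : HeightOneSpectrum R) :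
    Valued.v ((x : FiniteAdeleRing R K) v) ≠ 0 := by
  intro h
  have h1 := congrArg Valued.v (val_apply_mul_inv_apply x v)
  rw [map_mul, map_one, h, zero_mul] at h1
  exact zero_ne_one h1

/-- The components of a finite idele are non-zero. [folklore] -/
theorem apply_ne_zero (x : (FiniteAdeleRing R K)ˣ) (v : HeightOneSpectrum R) :
    (x : FiniteAdeleRing R K) v ≠ 0 := fun h =>
  valued_apply_ne_zero x v (by rw [h, map_zero])

variable (R K)

/-! ### The order of a finite idele at a place -/

/-- The **order** `ord_v x ∈ ℤ` of the finite idele `x` at the finite place `v`: the valuation of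
the `v`-component is `|x_v|_v = exp (-ord_v x)` in Mathlib's multiplicative notation `ℤᵐ⁰`
(`valued_apply_eq_exp_neg_unitOrd`).  Cassels–Fröhlich, Ch. II §17 (`α ↦ ∑ (ord_v α)·v`).
[cite: CasselsFrohlichANT1967, Ch. II §17] -/
def unitOrd (x : (FiniteAdeleRing R K)ˣ) (v : HeightOneSpectrum R) : ℤ :=
  -log (Valued.v ((x : FiniteAdeleRing R K) v))

variable {R K}

/-- `|x_v|_v = exp (-ord_v x)`. [folklore] -/
theorem valued_apply_eq_exp_neg_unitOrd (x : (FiniteAdeleRing R K)ˣ) (v : HeightOneSpectrum R) :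
    Valued.v ((x : FiniteAdeleRing R K) v) = exp (-unitOrd R K x v) := by
  rw [unitOrd, neg_neg, exp_log (valued_apply_ne_zero x v)]

/-- `ord_v (x y) = ord_v x + ord_v y`. [folklore] -/
theorem unitOrd_mul (x y : (FiniteAdeleRing R K)ˣ) (v : HeightOneSpectrum R) :
    unitOrd R K (x * y) v = unitOrd R K x v + unitOrd R K y v := by
  simp only [unitOrd, Units.val_mul]
  change -log (Valued.v ((x : FiniteAdeleRing R K) v * (y : FiniteAdeleRing R K) v)) = _
  rw [map_mul, log_mul (valued_apply_ne_zero x v) (valued_apply_ne_zero y v)]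
  ring

/-- `ord_v 1 = 0`. [folklore] -/
theorem unitOrd_one (v : HeightOneSpectrum R) : unitOrd R K 1 v = 0 := by
  simp only [unitOrd, Units.val_one, coe_one_apply, map_one, log_one, neg_zero]

/-- `ord_v (x⁻¹) = - ord_v x`. [folklore] -/
theorem unitOrd_inv (x : (FiniteAdeleRing R K)ˣ) (v : HeightOneSpectrum R) :
    unitOrd R K x⁻¹ v = -unitOrd R K x v := by
  have h := unitOrd_mul x x⁻¹ v
  rw [mul_inv_cancel, unitOrd_one] at h
  linarith

/-- `ord_v x = 0` iff `|x_v|_v = 1`. [folklore] -/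
theorem unitOrd_eq_zero_iff (x : (FiniteAdeleRing R K)ˣ) (v : HeightOneSpectrum R) :
    unitOrd R K x v = 0 ↔ Valued.v ((x : FiniteAdeleRing R K) v) = 1 := by
  rw [valued_apply_eq_exp_neg_unitOrd, ← exp_zero, exp_inj, neg_eq_zero]

/-- A finite idele has order `0` at all but finitely many places (Mathlib
`FiniteAdeleRing.unitsEquiv_finite_valued_eq_one`). Cassels–Fröhlich, Ch. II §16–17. [folklore] -/
theorem unitOrd_eventually_eq_zero (x : (FiniteAdeleRing R K)ˣ) :
    ∀ᶠ v in Filter.cofinite, unitOrd R K x v = 0 := by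
  filter_upwards [IsDedekindDomain.FiniteAdeleRing.unitsEquiv_finite_valued_eq_one x] with v hv
  exact (unitOrd_eq_zero_iff x v).2 hv

/-- The order at `v` of the principal finite idele of `k ∈ Kˣ` is `-log` of the `v`-adic valuation
of `k`. [folklore] -/
theorem unitOrd_unitEmbedding (k : Kˣ) (v : HeightOneSpectrum R) :
    unitOrd R K (IsDedekindDomain.FiniteAdeleRing.unitEmbedding R K k) v =
      -log (v.valuation K (k : K)) := by
  rw [unitOrd, IsDedekindDomain.FiniteAdeleRing.unitEmbedding_apply,
    IsDedekindDomain.FiniteAdeleRing.algebraMap_apply, valuedAdicCompletion_eq_valuation']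

variable (R K)

/-! ### The fractional ideal of a finite idele -/

/-- The **fractional ideal** `∏_v v ^ (ord_v x)` of a finite idele `x` (a genuine finite product,
`unitOrd_eventually_eq_zero`); the idelic version of Cassels–Fröhlich's map `J_k → I_k`,
`α ↦ ∑_v (ord_v α) · v`. [cite: CasselsFrohlichANT1967, Ch. II §17] -/
def toFractionalIdeal (x : (FiniteAdeleRing R K)ˣ) : FractionalIdeal R⁰ K :=
  ∏ᶠ v : HeightOneSpectrum R, (v.asIdeal : FractionalIdeal R⁰ K) ^ unitOrd R K x v

variable {R K}

/-- The fractional ideal of a finite idele is non-zero. [folklore] -/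
theorem toFractionalIdeal_ne_zero (x : (FiniteAdeleRing R K)ˣ) : toFractionalIdeal R K x ≠ 0 := by
  refine finprod_induction (fun I : FractionalIdeal R⁰ K => I ≠ 0) one_ne_zero
    (fun _ _ h h' => mul_ne_zero h h') fun v => ?_
  exact zpow_ne_zero _ (FractionalIdeal.coeIdeal_ne_zero.mpr v.ne_bot)

/-- The multiplicity of `v` in the fractional ideal of `x` is `ord_v x`
(Mathlib `FractionalIdeal.count_finprod`). [folklore] -/
theorem count_toFractionalIdeal (x : (FiniteAdeleRing R K)ˣ) (v : HeightOneSpectrum R) :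
    FractionalIdeal.count K v (toFractionalIdeal R K x) = unitOrd R K x v :=
  FractionalIdeal.count_finprod K v (unitOrd R K x) (unitOrd_eventually_eq_zero x)

end FiniteAdeleRing

variable {R K}

/-! ### The multiplicity of `v` in a principal fractional ideal -/

/-- **`val_v((k)) = ord_v(k)`**: for `k ∈ Kˣ`, the multiplicity of the prime `v` in the principal
fractional ideal `(k)` (Mathlib `FractionalIdeal.count`) is `-log` of the `v`-adic valuation of `k`
(Mathlib `HeightOneSpectrum.valuation`, `|k|_v = exp(-ord_v k)`).  Write `k = n/d`
(`n, d ∈ R`); both sides are `val_v(n) - val_v(d)` (Mathlib `FractionalIdeal.count_well_defined`,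
`HeightOneSpectrum.valuation_of_mk'`, `intValuation_if_neg`).  Cassels–Fröhlich, Ch. II §17
("the image of `kˣ` is the group of principal ideals"). [folklore] -/
theorem FractionalIdeal.count_spanSingleton_eq_neg_log_valuation (v : HeightOneSpectrum R)
    (k : Kˣ) :
    FractionalIdeal.count K v (FractionalIdeal.spanSingleton R⁰ (k : K)) =
      -log (v.valuation K (k : K)) := by
  classical
  obtain ⟨n, d, hnd⟩ := IsLocalization.exists_mk'_eq R⁰ (k : K)
  have hd0 : (d : R) ≠ 0 := nonZeroDivisors.ne_zero d.2
  have hn0 : n ≠ 0 := by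
    rintro rfl
    apply k.ne_zero
    rw [← hnd, IsLocalization.mk'_zero]
  have hd_ne_zero : algebraMap R K (d : R) ≠ 0 :=
    IsFractionRing.to_map_ne_zero_of_mem_nonZeroDivisors d.2
  have hI0 : FractionalIdeal.spanSingleton R⁰ (k : K) ≠ 0 :=
    FractionalIdeal.spanSingleton_ne_zero_iff.mpr k.ne_zero
  have hI : FractionalIdeal.spanSingleton R⁰ (k : K) =
      FractionalIdeal.spanSingleton R⁰ ((algebraMap R K) d)⁻¹ * ↑(Ideal.span {n} : Ideal R) := by
    rw [FractionalIdeal.coeIdeal_span_singleton, FractionalIdeal.spanSingleton_mul_spanSingleton]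
    apply congr_arg
    rw [← hnd, IsFractionRing.mk'_eq_div, div_eq_mul_inv, mul_comm]
  rw [FractionalIdeal.count_well_defined K v hI0 hI, ← hnd, valuation_of_mk',
    intValuation_if_neg v hn0, intValuation_if_neg v hd0, ← exp_sub, log_exp]
  ring

namespace FiniteAdeleRing

/-- The fractional ideal of the principal finite idele of `k ∈ Kˣ` has the same multiplicities as
the principal fractional ideal `(k)`: `ord_v (k) = val_v((k))`. [folklore] -/
theorem unitOrd_unitEmbedding_eq_count (k : Kˣ) (v : HeightOneSpectrum R) :
    unitOrd R K (IsDedekindDomain.FiniteAdeleRing.unitEmbedding R K k) v =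
      FractionalIdeal.count K v (FractionalIdeal.spanSingleton R⁰ (k : K)) := by
  rw [unitOrd_unitEmbedding, FractionalIdeal.count_spanSingleton_eq_neg_log_valuation]

variable (R K)

/-! ### The ideal class of a finite idele and the reduction theorem -/

/-- The **ideal class** of a finite idele: the class in `ClassGroup R` of its fractional ideal
`∏_v v ^ (ord_v x)` (Mathlib `ClassGroup.mk`). Cassels–Fröhlich, Ch. II §17. [folklore] -/
def idealClass (x : (FiniteAdeleRing R K)ˣ) : ClassGroup R :=
  ClassGroup.mk K (Units.mk0 (toFractionalIdeal R K x) (toFractionalIdeal_ne_zero x))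

variable {R K}

/-- Two finite ideles with the same ideal class differ by a principal idele times a unit idele:
if `[∏ v^(ord_v t)] = [∏ v^(ord_v x)]` in `ClassGroup R` then `x = k · t · u` with `k ∈ Kˣ` and
`ord_v u = 0` for all `v`.  (The quotient of the two fractional ideals is principal, `= (k)`, and
multiplicities are compared with `count_toFractionalIdeal` and
`FractionalIdeal.count_spanSingleton_eq_neg_log_valuation`.)  Cassels–Fröhlich, Ch. II §17.
[folklore] -/
theorem exists_unitOrd_eq_zero_of_idealClass_eq {x t : (FiniteAdeleRing R K)ˣ}
    (h : idealClass R K t = idealClass R K x) :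
    ∃ k : Kˣ, ∀ v, unitOrd R K (x * t⁻¹ * (IsDedekindDomain.FiniteAdeleRing.unitEmbedding R K k)⁻¹)
      v = 0 := by
  classical
  set It := Units.mk0 (toFractionalIdeal R K t) (toFractionalIdeal_ne_zero t) with hIt
  set Ix := Units.mk0 (toFractionalIdeal R K x) (toFractionalIdeal_ne_zero x) with hIx
  have h1 : ClassGroup.mk K (It⁻¹ * Ix) = 1 := by
    change ClassGroup.mk K It = ClassGroup.mk K Ix at h
    rw [map_mul, map_inv, h, inv_mul_cancel]
  rw [ClassGroup.mk_eq_one_iff] at h1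
  obtain ⟨g, hg⟩ := (FractionalIdeal.isPrincipal_iff _).1 h1
  have hg0 : g ≠ 0 := by
    rintro rfl
    rw [FractionalIdeal.spanSingleton_zero] at hg
    exact (It⁻¹ * Ix).ne_zero hg
  refine ⟨Units.mk0 g hg0, fun v => ?_⟩
  have hcount := congrArg (FractionalIdeal.count K v) hg
  rw [Units.val_mul, Units.val_inv_eq_inv_val, Units.val_mk0, Units.val_mk0,
    FractionalIdeal.count_mul K v (inv_ne_zero (toFractionalIdeal_ne_zero t))
      (toFractionalIdeal_ne_zero x),
    FractionalIdeal.count_inv, count_toFractionalIdeal, count_toFractionalIdeal] at hcount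
  rw [unitOrd_mul, unitOrd_mul, unitOrd_inv, unitOrd_inv, unitOrd_unitEmbedding_eq_count,
    Units.val_mk0, ← hcount]
  ring

/-- **Reduction of finite ideles modulo `Kˣ` and unit ideles to a finite set** (idelic form of
the finiteness of the class group).  If `ClassGroup R` is finite, there is a finite set `T` of
finite ideles such that every finite idele `x` is `x = k · t · u` with `k ∈ Kˣ` (principal idele),
`t ∈ T` and `u` a unit idele, `ord_v u = 0` for every `v`: take for `T` one idele in each ideal
class that contains ideles.  For `R = 𝓞 K` this is the class-number input to the compactness of
`J_K^1 / Kˣ` (Cassels–Fröhlich, Ch. II §17 Theorem, §18 closing remark: "It is more usual to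
deduce the compactness of `J_k^1/kˣ` from these theorems").
[cite: CasselsFrohlichANT1967, Ch. II §17 Theorem and §18 (closing remark)] -/
theorem exists_finset_forall_exists_unitOrd_eq_zero [Finite (ClassGroup R)] :
    ∃ T : Finset (FiniteAdeleRing R K)ˣ, ∀ x : (FiniteAdeleRing R K)ˣ, ∃ t ∈ T, ∃ k : Kˣ,
      ∀ v, unitOrd R K (x * t⁻¹ * (IsDedekindDomain.FiniteAdeleRing.unitEmbedding R K k)⁻¹)
        v = 0 := by
  classical
  haveI : Fintype (ClassGroup R) := Fintype.ofFinite _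
  -- one representative idele for each ideal class containing ideles
  let rep : ClassGroup R → (FiniteAdeleRing R K)ˣ := fun γ =>
    if hγ : ∃ t : (FiniteAdeleRing R K)ˣ, idealClass R K t = γ then hγ.choose else 1
  refine ⟨Finset.univ.image rep, fun x => ⟨rep (idealClass R K x), ?_, ?_⟩⟩
  · exact Finset.mem_image_of_mem rep (Finset.mem_univ _)
  · have hγ : ∃ t : (FiniteAdeleRing R K)ˣ, idealClass R K t = idealClass R K x := ⟨x, rfl⟩
    have hrep : idealClass R K (rep (idealClass R K x)) = idealClass R K x := by
      simp only [rep, dif_pos hγ]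
      exact hγ.choose_spec
    exact exists_unitOrd_eq_zero_of_idealClass_eq hrep

/-- A finite idele of order `0` at `v` is a **local unit** at `v`: its `v`-component, and that of
its inverse, are local integers (`u_v ∈ 𝒪_vˣ`). [folklore] -/
theorem mem_adicCompletionIntegers_of_unitOrd_eq_zero {u : (FiniteAdeleRing R K)ˣ}
    {v : HeightOneSpectrum R} (hu : unitOrd R K u v = 0) :
    (u : FiniteAdeleRing R K) v ∈ v.adicCompletionIntegers K ∧
      ((u⁻¹ : (FiniteAdeleRing R K)ˣ) : FiniteAdeleRing R K) v ∈ v.adicCompletionIntegers K := by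
  have h1 : Valued.v ((u : FiniteAdeleRing R K) v) = 1 := (unitOrd_eq_zero_iff u v).1 hu
  have h2 : Valued.v (((u⁻¹ : (FiniteAdeleRing R K)ˣ) : FiniteAdeleRing R K) v) = 1 := by
    rw [← unitOrd_eq_zero_iff, unitOrd_inv, hu, neg_zero]
  rw [mem_adicCompletionIntegers, mem_adicCompletionIntegers, h1, h2]
  exact ⟨le_rfl, le_rfl⟩

end FiniteAdeleRing

end Literature.NumberTheory.Automorphic
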